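import Summits.ResolutionOfSingularities.ResolutionOfSingularities.Theorems.EquisingularLiftEquisingularLiftNatUncentredConeGermConeForm
import HarnessLib

/-!
# [OURS · L1 W4.5(b) · EL♮(3)] S7 — transporting the cone form of `W` to the adapted frame; uniformizer irrelevance
# (crux `EquisingularLiftNatThree` = stmt-ResolutionOfSingularities-20148; consumer: B4a★′ `exists_centredConeLift_three_exact_coneForm`)

res-type-100 g12, object S7 `hBaseKCL` (res-D-pv-029 TOWER₃ assembly), centred chain. OURS; NOT a statement of any manuscript; AI-written,
weaker than expert review; `--supports stmt-ResolutionOfSingularities-20148 --as helper`; closes nothing. Definition-free.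

* `map_mem_of_irreducible_of_map_mem` — in a DVR any two uniformizers are associated, so `f ϖ' ∈ Q ⇒ f ϖ ∈ Q` for every ring map `f` and
  ideal `Q` (the «uniformizer irrelevance» of the Δ-regularity clauses).
* `exists_coneForm_transport` — in the model square at the special point, with the constants `ρ = j^♯_x ∘ ι : O → 𝒪_{F₁,x}` and a section
  frame `c` obtained from `c₀` by a translate-and-swap BY CONSTANTS (`c₀ i = c (swap 0 jj i) + ι(o i) · c 0`, T-FRAME-AT′): a cone form
  `φ` of `W` in the frame `c̄₀ = j^♯ c₀` (homogeneous of degree `d`, infinitely root-divisible coefficients, `𝓘⟨closure W⟩_x = (φ(c̄₀))`)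
  becomes a CONSTANT-COEFFICIENT form `Φ₁ = ρ_*Ψ` of degree `d` in the frame `c̄` with `𝓘⟨closure W⟩_x = (Φ₁(c̄))` and `Φ̄₁ ≠ 0`
  (characteristic `p`: …NatConeFormConstants `exists_map_eq_of_forall_coeff_pow`, `isHomogeneous_and_eval_map_bind₁`); also recorded:
  `π ∘ ρ` is onto the residue field and `π (ρ b) = 0 ⇒ ρ b = 0` (`residueModel_surjective_and_ker`, `stalkMap_model_varpi`).
-/

set_option linter.dupNamespace false -- mandated namespace `Summit.<Summit>.<Problem>` of this single-conjunct summit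
set_option linter.overlappingInstances false -- the binders carry `[IsDomain O] [IsDiscreteValuationRing O]`

noncomputable section

open CategoryTheory CategoryTheory.Limits AlgebraicGeometry TopologicalSpace IsLocalRing
open Literature.AlgebraicGeometry.Resolution
open AlgebraicGeometry.Scheme.IdealSheafData

namespace Summit.ResolutionOfSingularities.ResolutionOfSingularities.Cruxes.EquisingularLiftNat.Sections

/-- **Uniformizer irrelevance.** In a discrete valuation ring two irreducible elements are associated, so for every ring map `f` and
ideal `Q`: `f ϖ' ∈ Q ⇒ f ϖ ∈ Q`. [folklore] -/
theorem map_mem_of_irreducible_of_map_mem {O S : Type*} [CommRing O] [IsDomain O] [IsDiscreteValuationRing O] [CommRing S]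
    (f : O →+* S) {ϖ ϖ' : O} (hϖ : Irreducible ϖ) (hϖ' : Irreducible ϖ') {Q : Ideal S} (h : f ϖ' ∈ Q) : f ϖ ∈ Q := by
  obtain ⟨u, hu⟩ := IsDiscreteValuationRing.associated_of_irreducible O hϖ' hϖ
  rw [← hu, map_mul]
  exact Q.mul_mem_right _ h

section Transport

variable (O : Type) [CommRing O] [IsDomain O] [IsDiscreteValuationRing O]

/-- **The cone form of `W` in the adapted frame.** See the module docstring. [cite: ZariskiSamuel1960, Ch. VIII §1]
[OURS · L1 W4.5b] S7 centred chain; NOT a statement of the manuscript. -/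
theorem exists_coneForm_transport (p : ℕ) [Fact p.Prime] (k : Type) [Field k] [CharP k p] (θ : O →+* k)
    (hθ : Function.Surjective θ) {X' F₁ F₂ : Scheme.{0}} (r' : X' ⟶ Spec (.of O)) (j : F₁ ⟶ X') (t : F₁ ⟶ Spec (.of k))
    (hsq : IsPullback j t r' (Spec.map (CommRingCat.ofHom θ))) (x : F₁) (hx : IsClosed ({x} : Set F₁))
    (υ : F₂ ⟶ F₁) (hυ : IsBlowup υ (vanishingIdeal ⟨{x}, hx⟩)) [IsLocallyNoetherian F₂] [IsRegularLocalRing (F₁.presheaf.stalk x)]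
    (c c₀ : Fin 3 → X'.presheaf.stalk (j x)) (θR : (X'.presheaf.stalk (j x) ⧸ Ideal.span (Set.range c)) ≃+* O)
    (hθR : ∀ b : O, θR (Ideal.Quotient.mk _ ((X'.presheaf.Γgerm (j x)).hom
      (r'.appTop.hom ((Scheme.ΓSpecIso (.of O)).inv.hom b)))) = b)
    (hcb𝔪 : Ideal.span (Set.range fun i => (j.stalkMap x).hom (c i)) = maximalIdeal (F₁.presheaf.stalk x))
    (jj : Fin 3) (o : Fin 3 → O) (hrel : ∀ i, c₀ i = c (Equiv.swap 0 jj i) +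
      (X'.presheaf.Γgerm (j x)).hom (r'.appTop.hom ((Scheme.ΓSpecIso (.of O)).inv.hom (o i))) * c 0)
    (W : Set F₁) (hnot : ¬ (υ ⁻¹' {x} ⊆ closure (υ ⁻¹' (W \ {x})))) {d : ℕ}
    (φ : MvPolynomial (Fin 3) (F₁.presheaf.stalk x)) (hφd : φ.IsHomogeneous d)
    (hroot : ∀ (α : Fin 3 →₀ ℕ) (e : ℕ), 0 < e → ∃ b : F₁.presheaf.stalk x, b ^ e = φ.coeff α)
    (hW₀ : stalkIdeal (vanishingIdeal (⟨closure W, isClosed_closure⟩ : Closeds F₁)) x =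
      Ideal.span {MvPolynomial.eval (fun i => (j.stalkMap x).hom (c₀ i)) φ}) :
    Function.Surjective ((Ideal.Quotient.mk (Ideal.span (Set.range fun i => (j.stalkMap x).hom (c i)))).comp
      ((j.stalkMap x).hom.comp ((Scheme.ΓSpecIso (.of O)).inv ≫ r'.appTop ≫ X'.presheaf.Γgerm (j x)).hom)) ∧
    (∀ b : O, Ideal.Quotient.mk (Ideal.span (Set.range fun i => (j.stalkMap x).hom (c i)))
        (((j.stalkMap x).hom.comp ((Scheme.ΓSpecIso (.of O)).inv ≫ r'.appTop ≫ X'.presheaf.Γgerm (j x)).hom) b) = 0 →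
      ((j.stalkMap x).hom.comp ((Scheme.ΓSpecIso (.of O)).inv ≫ r'.appTop ≫ X'.presheaf.Γgerm (j x)).hom) b = 0) ∧
    ∃ (Ψ : MvPolynomial (Fin 3) O) (Φ₁ : MvPolynomial (Fin 3) (F₁.presheaf.stalk x)),
      Φ₁ = MvPolynomial.map ((j.stalkMap x).hom.comp ((Scheme.ΓSpecIso (.of O)).inv ≫ r'.appTop ≫ X'.presheaf.Γgerm (j x)).hom) Ψ ∧
      Φ₁.IsHomogeneous d ∧
      stalkIdeal (vanishingIdeal (⟨closure W, isClosed_closure⟩ : Closeds F₁)) x =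
        Ideal.span {MvPolynomial.eval (fun i => (j.stalkMap x).hom (c i)) Φ₁} ∧
      MvPolynomial.map (Ideal.Quotient.mk (Ideal.span (Set.range fun i => (j.stalkMap x).hom (c i)))) Φ₁ ≠ 0 := by
  haveI : CharP (F₁.presheaf.stalk x) p :=
    charP_of_injective_ringHom (((Scheme.ΓSpecIso (.of k)).inv ≫ t.appTop ≫ F₁.presheaf.Γgerm x).hom.injective) p
  obtain ⟨ρ, hρdef⟩ : ∃ ρ : O →+* F₁.presheaf.stalk x,
      ρ = (j.stalkMap x).hom.comp ((Scheme.ΓSpecIso (.of O)).inv ≫ r'.appTop ≫ X'.presheaf.Γgerm (j x)).hom := ⟨_, rfl⟩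
  rw [← hρdef]
  have hkermk : RingHom.ker (Ideal.Quotient.mk (Ideal.span (Set.range fun i => (j.stalkMap x).hom (c i)))) =
      maximalIdeal (F₁.presheaf.stalk x) := Ideal.mk_ker.trans hcb𝔪
  have hπρ := residueModel_surjective_and_ker θ hθ r' j t hsq x c θR hθR hcb𝔪 rfl
  have hsurjρ : Function.Surjective ((Ideal.Quotient.mk (Ideal.span (Set.range fun i => (j.stalkMap x).hom (c i)))).comp ρ) := by
    rw [hρdef, ← RingHom.comp_assoc]; exact hπρ.1
  have hkerρ : ∀ b : O, Ideal.Quotient.mk (Ideal.span (Set.range fun i => (j.stalkMap x).hom (c i))) (ρ b) = 0 → ρ b = 0 := by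
    intro b hb
    have hb𝔪 : b ∈ maximalIdeal O := by
      rw [← hπρ.2, RingHom.mem_ker]; rw [hρdef] at hb; exact hb
    rw [hρdef]
    exact stalkMap_model_varpi θ hθ r' j t hsq x b hb𝔪
  refine ⟨hsurjρ, hkerρ, ?_⟩
  -- constants: `φ = ρ_*Φφ` (characteristic `p`)
  obtain ⟨Φφ, hΦφ⟩ := exists_map_eq_of_forall_coeff_pow ρ (Ideal.Quotient.mk _) hkermk hsurjρ hkerρ p φ hroot
  -- the linear forms of the frame change
  obtain ⟨L, hL⟩ : ∃ L : Fin 3 → MvPolynomial (Fin 3) O,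
      ∀ i, L i = MvPolynomial.X (Equiv.swap 0 jj i) + MvPolynomial.C (o i) * MvPolynomial.X 0 := ⟨_, fun _ => rfl⟩
  have hL1 : ∀ i, (L i).IsHomogeneous 1 := fun i => by
    rw [hL]
    exact (MvPolynomial.isHomogeneous_X _ _).add ((MvPolynomial.isHomogeneous_C _ _).mul (MvPolynomial.isHomogeneous_X _ _))
  have hrel' : ∀ i, MvPolynomial.eval (fun i => (j.stalkMap x).hom (c i)) (MvPolynomial.map ρ (L i)) =
      (j.stalkMap x).hom (c₀ i) := fun i => by
    rw [hrel i, hL, map_add, map_mul, MvPolynomial.map_X, MvPolynomial.map_C, MvPolynomial.map_X, map_add, map_mul,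
      MvPolynomial.eval_X, MvPolynomial.eval_C, MvPolynomial.eval_X, map_add, map_mul, hρdef]
    rfl
  have htrans := isHomogeneous_and_eval_map_bind₁ ρ (fun i => (j.stalkMap x).hom (c i)) (fun i => (j.stalkMap x).hom (c₀ i)) L
    hL1 hrel' Φφ (d := d) (by rw [hΦφ]; exact hφd)
  have hW : stalkIdeal (vanishingIdeal (⟨closure W, isClosed_closure⟩ : Closeds F₁)) x =
      Ideal.span {MvPolynomial.eval (fun i => (j.stalkMap x).hom (c i)) (MvPolynomial.map ρ (MvPolynomial.bind₁ L Φφ))} := by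
    rw [htrans.2, hΦφ]; exact hW₀
  refine ⟨MvPolynomial.bind₁ L Φφ, _, rfl, htrans.1, hW, ?_⟩
  exact map_map_ne_zero_of_span_eval_ne_bot ρ (Ideal.Quotient.mk _) hkerρ _ (MvPolynomial.bind₁ L Φφ)
    (by rw [← hW]; exact stalkIdeal_vanishingIdeal_closure_ne_bot hx hυ W hnot)

end Transport

end Summit.ResolutionOfSingularities.ResolutionOfSingularities.Cruxes.EquisingularLiftNat.Sections

end
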